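import Summits.HodgeConjecture.HodgeConjecture.Theorems.Ring2AbelianAllSpreadFloorHeredity
import Summits.HodgeConjecture.HodgeConjecture.Theorems.Ring2DeformFrameRows
import HarnessLib

/-!
# Ring 2 · AbelianAll · SPREADING axis, part XXVII — THE FLOOR UNDER HAZAMA'S CODIMENSION-TWO REDUCTION:
# `CM↑` HOLDS modulo Hazama 2003 (a refereed theorem in print, the tree's named fact `h83`), so MODULO THE TWO RECORDS
# `hF` (Deligne 1982, Prop. 6.1) and `h83` (Hazama 2003, Thm. 8.3) the four anchored floor nodes N1 ≡ N102 ≡ N103 ≡ N104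
# AND THE SERVED ITEM `CMToAbelian` (`HC_CM → HC_AV`, stmt-HodgeConjecture-16267) ARE ONE STATEMENT. `HC_CM` is nowhere a binder.

research route, not a corollary; conditional on HC_CM plus one named minimal statement.
(Cell line: research route conditional on HC_CM; not a corollary; Q11.4-sentence-2 already refuted in dim ≥ 3.)

Seat `pub-hodge-ring2-ab-spread-1` (SPREADING), generation 30. Nothing in this file is a case of the Hodge conjecture; NO node /
def / abbrev / named fact is minted (0 `def`); the codimension-graded shapes `HC_AV⁽p⁾`, `HC_CM⁽p⁾` and the upward heredity
`CM↑ := ∀ p m, 2 ≤ p → p ≤ m → HC_CM⁽p⁾ → HC_CM⁽m⁾` are parts XXV/XXVI's DISPLAY-ONLY local notations (unfoldings of the EXISTING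
constants `HodgeAbelianVarieties` = `HC_AV` and `CMAbelianHodge` = `HC_CM`). The item `Theses.RankFourFaces.CMToAbelian` stays OPEN.
`HC_CM` occurs below ONLY as the conclusion of implications whose open inputs are explicit binders (§2) — never as a hypothesis,
never as a fact. The two printed theorems enter as DISPLAYED named-fact binders, never asserted:
`hF := Deligne1982.deligne1982_cmDenseMumfordTateFamilies` (CM points are dense in Mumford–Tate families) and
`h83 := HodgeTheory.Hazama2003_generalHodge_cmType_of_hodge_codimTwo` (REFEREED record of the cell `pub-hodgecm`; F. Hazama,
Publ. RIMS 39 (2003), Abstract p. 625: "The General Hodge Conjecture for abelian varieties of CM-type is shown to be implied by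
the usual Hodge Conjecture for those up to codimension two", Thm. 8.3 p. 655; restated by Milne, AIM talk, Thm. 8.5: "In order to
prove the Hodge conjecture for CM abelian varieties over `ℂ`, it suffices to prove it in codimension 2"). COUNT ONCE: the packaged
`HC_CM ↔ ∀ B, HC⁽²⁾(B)` on the binder is the deformation axis' `Ring2.Deform.HC_CM_iff_forall_codimTwo_of_hazama2003` (part XIV §D,
2026-08-19; also typer 2's part XXII §C1) and is used BY NAME; this file adds only the one-line bridge from the display shape `HC_CM⁽2⁾`
to that record's hypothesis `∀ B, CMHodgeCodimTwoHypothesisAt B` (§1) and what the record does to the spreading floor (§§2–7).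

## ERRATUM to part XXVI (page 1, §3 and honest column (a)) and to the seat's gen-29 record "(A) no tool known"

Part XXVI isolated the entire possible difference between `F_CM^mid` (N104) and `F_CM` (N1) in the displayed hypothesis `CM↑`
("a CM failure can be LOWERED in codimension, down to codimension 2") and wrote "this pen knows no other tool for it" / "a separating
model satisfies `HC_CM⁽2⁾ ∧ ¬HC_CM`; none is known or claimed". THE TOOL IS IN PRINT AND IN THE TREE: Hazama 2003 Thm. 8.3 says exactly
`HC_CM⁽2⁾ → HC_CM` (indeed `→ GHC_CM`), i.e. `CM↑` (part XXVI `cmCodimUp_iff_codim_two_imp_HC_CM`). Granted the record, NO model separates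
N104 from N1 (§5 `not_middle_and_not_floor_of_hazama2003_of_deligne1982`), and more (§§3–5): NO model separates either of them from the
served item. The gen-29 sentences were true as written ("known to this pen") and are superseded, not contradicted, by a theorem of 2003
vendored into the tree two days earlier by another cell; the oversight is this seat's.

## What is proved

* §1 (NO fact) `HC_CM⁽2⁾ ↔ ∀ B, CMHodgeCodimTwoHypothesisAt B` (the record's hypothesis; the smooth-projective guard is the tree
  theorem `AbelianVariety.isSmoothProjective_holds`).
* §2 (mod `h83`, displayed) `HC_CM⁽2⁾ → HC_CM` (deform XIV's iff, by name), hence **`CM↑`**, and `HC_CM⁽p⁾ ↔ HC_CM` for every `p ≥ 2`: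
  granted Hazama's theorem the codimension grading of `HC_CM` is CONSTANT from codimension `2` on (codimensions `0, 1` classical).
* §3 (NO fact, under the displayed `CM↑`) `CMToAbelian → ∀ p, (HC_CM⁽p⁾ → HC_AV⁽p⁾)`, so `(∀ p, HC_CM⁽p⁾ → HC_AV⁽p⁾) ↔ CMToAbelian`:
  under `CM↑` the GRADED item of part XXV IS the ungraded (served) item.
* §4 (mod `hF`, under `CM↑`) `F_CM ↔ CMToAbelian` and `F_CM^mid ↔ CMToAbelian` (part XXV's exact locations + §3 + part XXVI §2).
* §5 (mod `hF ∧ h83`, `HC_CM`-FREE — the headline) **`F_CM ↔ CMToAbelian`, `F_CM^mid ↔ CMToAbelian`, `F_CM^mid ↔ F_CM`, and the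
  five-fold collapse `N1 ≡ N102 ≡ N103 ≡ N104 ≡ item`** (`spreadFloor_collapse_onto_item_of_hazama2003_of_deligne1982`, with part
  XXIII's fact-free `spreadFloor_nodes_collapse`); no model of `F_CM^mid ∧ ¬F_CM` or of `CMToAbelian ∧ ¬F_CM` exists granted the two
  records. The v48 typed preorder's one-way edges `N1 ⟹ N104 ⟹ item` acquire their converses MODULO `{hF, h83}` (fact-free they stay
  one-way; under `HC_CM` alone everything is `↔ HC_AV`, parts VII/XXIV).
* §6 (mod `h83` alone) `HC_AV ↔ HC_CM⁽2⁾ ∧ F_CM^mid`: the brief's `HC_AV_of_HC_CM_and_Bmin` (part XXIV, `B_min := F_CM^mid`) with its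
  first hypothesis CUT DOWN to codimension-two Hodge classes on CM abelian varieties — the instance `B := F_CM^mid` of deform XIV's
  generic `closesWithCM_iff_codimTwo_of_hazama2003`, count once.
* §7 (mod `hF ∧ h83`) THE POINTWISE READING, final form: at every rational `(p,p)`-class `c` on `A` (any `p`), the instance of `F_CM`
  at `(A, p, c)` holds iff (`c` is a Hodge failure ⟹ `¬HC_CM`) — the anchored datum at a failure carries NO information beyond
  "`HC_CM` fails somewhere" (part XXV: "beyond `p`"; Hazama removes `p`).
* §8 the assembled reading `spreadFloor_hazama_reading_of_deligne1982`.

## Honest column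

(a) DEFLATION OF THE AXIS, stated plainly: granted two refereed theorems in print (Deligne 1982 Prop. 6.1; Hazama 2003 Thm. 8.3),
displayed as binders and never asserted, EVERY anchored floor node of the spreading axis (N1, N102, N103, N104) is EQUIVALENT to the
bare served item `HC_CM → HC_AV`; the CM-anchored-family language adds nothing to the item modulo print. `B_min` of record (census
v48: N104) is thus `≡ item mod {hF, h83}`; the exact complement everything collapses to is the TAUTOLOGICAL one, `HC_AV ↔ HC_CM ∧
(HC_CM → HC_AV)` (frame I `exactWithCM_cmToAbelian`, displayed in §8). "Minimal" is claimed for nothing; the B_min sentence and the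
census placement of these rows are the LEAD's call.
(b) What is NOT deflated: fact-free, `N1 ⟹ N104 ⟹ item` stay one-way in the kernel; the converses need `hF` (item/N104 ⟹ N1) resp.
`hF ∧ h83`; nobody asserts `hF` or `h83` — they are theorems in print vendored as named facts, and any consumer displays them.
(c) `CM↑` stays a displayed hypothesis (no def, node, fact); §2 DISCHARGES it modulo `h83`. Part XXVI (c) "implied by `HC_CM`, so NOT
an `HC_CM`-free input" is superseded: `CM↑` IS `HC_CM`-free modulo Hazama's record.
(d) The record `h83` is the IMPLICATION "(codimension-two Hodge classes on all CM abelian varieties algebraic) ⟹ `GHC_CM`", weaker than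
Thm. 8.3 as printed (which needs them only on Hazama's `A_{A(2ⁿ)}(G; K)`), the safe direction (its docstring; referee mc-ref R-10);
`GHC_CM → HC_CM` is Grothendieck 1969 p. 301, unconditional in the tree. Nothing here uses more than `HC_CM⁽2⁾ → HC_CM`.
(e) INFORMATIVENESS CAVEAT of part XXVI (b) is now sharp: mod `hF ∧ h83` the floor nodes hold outright iff `HC_CM` fails OR `HC_AV`
holds — i.e. they are the item. Standing of every node, of the item (OPEN) and of `HC_CM` (OPEN, a binder elsewhere, absent here) is
unchanged; no case of the Hodge conjecture is proved.

References: Hazama2003GHCCM (Abstract p. 625, §1, Thm. 8.3 p. 655); Hazama2002GHCCM (Thm. 7.6 p. 75); Milne2007TateFiniteFieldsAIM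
(Thm. 8.5); GrothendieckTopology1969 (p. 301); Deligne1982HodgeCycles (Prop. 6.1 (a)(b), p. 71); BrosnanFangNiePearlstein2009 (§6
Lemma 48); VoisinHodgeI2002 (Thm. 11.30, §11.3.3); Milne1999 (§2 p. 54, §7 (H)); Andre1996Motifs (§1.3 p. 12).
-/

noncomputable section

set_option linter.dupNamespace false

open CategoryTheory AlgebraicGeometry
open Literature.AlgebraicGeometry Literature.AlgebraicGeometry.Motives
open Literature.AlgebraicGeometry.HodgeTheory
open Literature.AlgebraicGeometry.Milne1999 (IsOfCMType)
open Literature.AlgebraicGeometry.Deligne1982 (deligne1982_cmDenseMumfordTateFamilies)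
open Literature.AlgebraicTopology.SingularHomology

namespace Summit.HodgeConjecture.HodgeConjecture.Ring2.AbelianAll

open Summit.HodgeConjecture.HodgeConjecture
open Summit.HodgeConjecture.HodgeConjecture.Theorems
open Summit.HodgeConjecture.HodgeConjecture.Theses
open Summit.HodgeConjecture.HodgeConjecture.Theses.RankFourFaces (CMAbelianHodge CMToAbelian)
open Summit.HodgeConjecture.HodgeConjecture.Theses.PadicSemiregularLift (HodgeAbelianVarieties)
open Summit.HodgeConjecture.HodgeConjecture.Ring2.Deform (cmLocus HC_CM_iff_forall_codimTwo_of_hazama2003)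

/-! ## §0 Display-only shapes (parts XXV/XXVI verbatim; NO def, NO abbrev, nothing enters the census) -/

/-- `HC_AV⁽p⁾` — DISPLAY ONLY: the Hodge conjecture for complex abelian varieties in codimension `p`. -/
local notation3 (prettyPrint := false) "HC_AV⁽" p "⁾" =>
  ∀ (A : AbelianVariety ℂ) (c : complexBetti A.X (2 * p)), IsRationalClass c →
    IsOfHodgeType A.dim A.X (2 * p) p p c → c ∈ algebraicClasses A.X p

/-- `HC_CM⁽p⁾` — DISPLAY ONLY: the Hodge conjecture for CM abelian varieties in codimension `p`. -/
local notation3 (prettyPrint := false) "HC_CM⁽" p "⁾" =>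
  ∀ (A : AbelianVariety ℂ), IsOfCMType A → ∀ (c : complexBetti A.X (2 * p)), IsRationalClass c →
    IsOfHodgeType A.dim A.X (2 * p) p p c → c ∈ algebraicClasses A.X p

/-- `CM↑` — DISPLAY ONLY: upward heredity of `HC_CM` in codimension from codimension `2` on (part XXVI). -/
local notation3 (prettyPrint := false) "CM↑" =>
  ∀ (p m : ℕ), 2 ≤ p → p ≤ m → HC_CM⁽p⁾ → HC_CM⁽m⁾

/-! ## §1 Fact-free: the display shape `HC_CM⁽2⁾` IS the hypothesis of Hazama's record -/

/-- **`HC_CM⁽2⁾ ↔ ∀ B, CMHodgeCodimTwoHypothesisAt B`**, NO fact: the record's per-variety hypothesis is the `p = 2` clause guarded by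
smooth-projectivity (a tree theorem for abelian varieties, `AbelianVariety.isSmoothProjective_holds`) and `Milne1999.IsOfCMType`, and
`complexBetti` is the tree's `singularCohomology` with complex coefficients. [cite: Hazama2003GHCCM, §1 p. 625 and Thm. 8.3 p. 655] -/
theorem forall_codim_CM_two_iff_forall_cmHodgeCodimTwoHypothesisAt :
    HC_CM⁽2⁾ ↔ ∀ B : AbelianVariety ℂ, CMHodgeCodimTwoHypothesisAt B :=
  ⟨fun h B _ hB c hc hpp ↦ h B hB c hc hpp,
    fun h B hB c hc hpp ↦ h B (AbelianVariety.isSmoothProjective_holds (A := B)) hB c hc hpp⟩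

/-! ## §2 Modulo Hazama's record: `HC_CM⁽2⁾ → HC_CM`, hence `CM↑`, and the grading of `HC_CM` is constant from codimension 2 on -/

/-- **`HC_CM⁽2⁾ → HC_CM`**, MOD `h83` (displayed): deform XIV's `HC_CM_iff_forall_codimTwo_of_hazama2003` (count once, by name) after §1.
`HC_CM` is the CONCLUSION; its inputs are the record and the open codimension-two hypothesis, both binders.
[cite: Hazama2003GHCCM, Abstract p. 625 and Thm. 8.3 p. 655] [cite: Milne2007TateFiniteFieldsAIM, Thm. 8.5] -/
theorem HC_CM_of_forall_codim_CM_two_of_hazama2003 (h83 : Hazama2003_generalHodge_cmType_of_hodge_codimTwo) (h2 : HC_CM⁽2⁾) :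
    CMAbelianHodge :=
  (HC_CM_iff_forall_codimTwo_of_hazama2003 h83).2 (forall_codim_CM_two_iff_forall_cmHodgeCodimTwoHypothesisAt.1 h2)

/-- **`CM↑` HOLDS modulo Hazama's record** (part XXVI's displayed separating hypothesis, discharged): `CM↑ ↔ (HC_CM⁽2⁾ → HC_CM)`
(part XXVI, fact-free) and the right-hand side is Hazama's theorem. `HC_CM` is NOT a binder.
[cite: Hazama2003GHCCM, Thm. 8.3 p. 655] [cite: Milne2007TateFiniteFieldsAIM, Thm. 8.5] -/
theorem cmCodimUp_of_hazama2003 (h83 : Hazama2003_generalHodge_cmType_of_hodge_codimTwo) : CM↑ :=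
  cmCodimUp_iff_codim_two_imp_HC_CM.2 (HC_CM_of_forall_codim_CM_two_of_hazama2003 h83)

/-- **`HC_CM⁽p⁾ ↔ HC_CM` for every `p ≥ 2`**, MOD `h83` (displayed): downward heredity to codimension `2` (part XXVI
`forall_codim_CM_of_le`), Hazama, and the unfolding `HC_CM ↔ ∀ p, HC_CM⁽p⁾` (part XXV). Granted the record, a failure of `HC_CM`
in ANY codimension yields one in EVERY codimension `≥ 2`. [cite: Hazama2003GHCCM, Thm. 8.3 p. 655]
[cite: BrosnanFangNiePearlstein2009, §6 Lemma 48] -/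
theorem forall_codim_CM_iff_HC_CM_of_two_le_of_hazama2003 (h83 : Hazama2003_generalHodge_cmType_of_hodge_codimTwo) {p : ℕ}
    (hp : 2 ≤ p) : HC_CM⁽p⁾ ↔ CMAbelianHodge :=
  ⟨fun h ↦ HC_CM_of_forall_codim_CM_two_of_hazama2003 h83 (forall_codim_CM_of_le hp h),
    fun h ↦ HC_CM_iff_forall_codim.1 h p⟩

/-! ## §3 Fact-free, under the displayed `CM↑`: the graded item IS the served item -/

/-- **`CM↑ → CMToAbelian → ∀ p, (HC_CM⁽p⁾ → HC_AV⁽p⁾)`**, NO fact: codimensions `0, 1` classical (part XXVI); for `p ≥ 2`,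
`HC_CM⁽p⁾ → HC_CM⁽2⁾ → HC_CM` (downward heredity, `CM↑`), then the item and the unfolding of `HC_AV` (part XXV). [folklore] -/
theorem forall_codim_cmToAbelian_of_cmToAbelian_of_cmCodimUp (hU : CM↑) (h : CMToAbelian) (p : ℕ) (hCMp : HC_CM⁽p⁾) :
    HC_AV⁽p⁾ := by
  rcases Nat.lt_or_ge p 2 with hp | hp
  · interval_cases p
    · exact forall_codim_AV_zero
    · exact forall_codim_AV_one
  · have hCM : CMAbelianHodge := cmCodimUp_iff_codim_two_imp_HC_CM.1 hU (forall_codim_CM_of_le hp hCMp)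
    exact cmToAbelian_iff_forall_codim_imp.1 h (HC_CM_iff_forall_codim.1 hCM) p

/-- **Under `CM↑`, `(∀ p, HC_CM⁽p⁾ → HC_AV⁽p⁾) ↔ CMToAbelian`**, NO fact (`→` is part XXV's `cmToAbelian_of_forall_codim_cmToAbelian`).
[folklore] -/
theorem forall_codim_cmToAbelian_iff_cmToAbelian_of_cmCodimUp (hU : CM↑) :
    (∀ p : ℕ, HC_CM⁽p⁾ → HC_AV⁽p⁾) ↔ CMToAbelian :=
  ⟨cmToAbelian_of_forall_codim_cmToAbelian, fun h p ↦ forall_codim_cmToAbelian_of_cmToAbelian_of_cmCodimUp hU h p⟩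

/-! ## §4 Modulo `hF`, under `CM↑`: both floor nodes are the item -/

/-- **`CM↑ → (F_CM ↔ CMToAbelian)`**, MOD `hF` (displayed): part XXV's exact location `F_CM ↔ ∀ p (HC_CM⁽p⁾ → HC_AV⁽p⁾)` and §3.
[cite: Deligne1982HodgeCycles, Prop. 6.1 (a)(b) (p. 71)] -/
theorem hodgeFailureSpreadsToCMFibre_iff_cmToAbelian_of_cmCodimUp_of_deligne1982 (hF : deligne1982_cmDenseMumfordTateFamilies)
    (hU : CM↑) : HodgeFailureSpreadsToCMFibre ↔ CMToAbelian :=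
  (hodgeFailureSpreadsToCMFibre_iff_forall_codim_cmToAbelian_of_deligne1982 hF).trans
    (forall_codim_cmToAbelian_iff_cmToAbelian_of_cmCodimUp hU)

/-- **`CM↑ → (F_CM^mid ↔ CMToAbelian)`**, MOD `hF` (displayed): part XXVI's `F_CM ↔ F_CM^mid` under `CM↑` and the previous row.
[cite: Deligne1982HodgeCycles, Prop. 6.1 (a)(b) (p. 71)] -/
theorem middleHodgeFailureSpreadsToCMFibre_iff_cmToAbelian_of_cmCodimUp_of_deligne1982
    (hF : deligne1982_cmDenseMumfordTateFamilies) (hU : CM↑) : MiddleHodgeFailureSpreadsToCMFibre ↔ CMToAbelian :=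
  (hodgeFailureSpreadsToCMFibre_iff_middle_of_cmCodimUp_of_deligne1982 hF hU).symm.trans
    (hodgeFailureSpreadsToCMFibre_iff_cmToAbelian_of_cmCodimUp_of_deligne1982 hF hU)

/-! ## §5 Modulo `hF ∧ h83`, `HC_CM`-free: the floor collapses onto the item -/

/-- **`F_CM ↔ CMToAbelian` (N1 ≡ item)**, MOD `hF ∧ h83` (both displayed), NO `HC_CM` binder.
[cite: Deligne1982HodgeCycles, Prop. 6.1 (a)(b) (p. 71)] [cite: Hazama2003GHCCM, Thm. 8.3 p. 655] -/
theorem hodgeFailureSpreadsToCMFibre_iff_cmToAbelian_of_hazama2003_of_deligne1982 (hF : deligne1982_cmDenseMumfordTateFamilies)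
    (h83 : Hazama2003_generalHodge_cmType_of_hodge_codimTwo) : HodgeFailureSpreadsToCMFibre ↔ CMToAbelian :=
  hodgeFailureSpreadsToCMFibre_iff_cmToAbelian_of_cmCodimUp_of_deligne1982 hF (cmCodimUp_of_hazama2003 h83)

/-- **`F_CM^mid ↔ CMToAbelian` (N104 ≡ item)**, MOD `hF ∧ h83` (both displayed), NO `HC_CM` binder: `B_min` of record IS the item
modulo the two records. [cite: Deligne1982HodgeCycles, Prop. 6.1 (a)(b) (p. 71)] [cite: Hazama2003GHCCM, Thm. 8.3 p. 655] -/
theorem middleHodgeFailureSpreadsToCMFibre_iff_cmToAbelian_of_hazama2003_of_deligne1982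
    (hF : deligne1982_cmDenseMumfordTateFamilies) (h83 : Hazama2003_generalHodge_cmType_of_hodge_codimTwo) :
    MiddleHodgeFailureSpreadsToCMFibre ↔ CMToAbelian :=
  middleHodgeFailureSpreadsToCMFibre_iff_cmToAbelian_of_cmCodimUp_of_deligne1982 hF (cmCodimUp_of_hazama2003 h83)

/-- **`F_CM^mid ↔ F_CM` (N104 ≡ N1)**, MOD `hF ∧ h83` (both displayed): part XXVI's separating hypothesis `CM↑` discharged by §2.
[cite: Deligne1982HodgeCycles, Prop. 6.1 (a)(b) (p. 71)] [cite: Hazama2003GHCCM, Thm. 8.3 p. 655] -/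
theorem middleHodgeFailureSpreadsToCMFibre_iff_hodgeFailureSpreadsToCMFibre_of_hazama2003_of_deligne1982
    (hF : deligne1982_cmDenseMumfordTateFamilies) (h83 : Hazama2003_generalHodge_cmType_of_hodge_codimTwo) :
    MiddleHodgeFailureSpreadsToCMFibre ↔ HodgeFailureSpreadsToCMFibre :=
  (hodgeFailureSpreadsToCMFibre_iff_middle_of_cmCodimUp_of_deligne1982 hF (cmCodimUp_of_hazama2003 h83)).symm

/-- **THE FIVE-FOLD COLLAPSE: N1 ≡ N102 ≡ N103 ≡ N104 ≡ item**, MOD `hF ∧ h83` (both displayed), NO `HC_CM` binder — each anchored floor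
node of the spreading axis is equivalent to the served item `CMToAbelian`; N1 ≡ N102 ≡ N103 is part XXIII's fact-free
`spreadFloor_nodes_collapse`. "Minimal" claimed for nothing. [cite: Deligne1982HodgeCycles, Prop. 6.1 (a)(b) (p. 71)]
[cite: Hazama2003GHCCM, Thm. 8.3 p. 655] [cite: Andre1996Motifs, §1.3 (p. 12)] -/
theorem spreadFloor_collapse_onto_item_of_hazama2003_of_deligne1982 (hF : deligne1982_cmDenseMumfordTateFamilies)
    (h83 : Hazama2003_generalHodge_cmType_of_hodge_codimTwo) :
    (HodgeFailureSpreadsToCMFibre ↔ CMToAbelian) ∧ (PrimitiveHodgeFailureSpreadsToCMFibre ↔ CMToAbelian) ∧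
      (EvenPrimitiveHodgeFailureSpreadsToCMFibre ↔ CMToAbelian) ∧ (MiddleHodgeFailureSpreadsToCMFibre ↔ CMToAbelian) :=
  have h1 := hodgeFailureSpreadsToCMFibre_iff_cmToAbelian_of_hazama2003_of_deligne1982 hF h83
  ⟨h1, hodgeFailureSpreadsToCMFibre_iff_primitiveHodgeFailureSpreadsToCMFibre.symm.trans h1,
    hodgeFailureSpreadsToCMFibre_iff_evenPrimitiveHodgeFailureSpreadsToCMFibre.symm.trans h1,
    middleHodgeFailureSpreadsToCMFibre_iff_cmToAbelian_of_hazama2003_of_deligne1982 hF h83⟩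

/-- **NO MODEL SEPARATES N104 FROM N1 granted the two records**: `¬(F_CM^mid ∧ ¬F_CM)`, MOD `hF ∧ h83` (both displayed) — the typed
correction of part XXVI (a) "none is known or claimed". [cite: Deligne1982HodgeCycles, Prop. 6.1 (a)(b) (p. 71)]
[cite: Hazama2003GHCCM, Thm. 8.3 p. 655] -/
theorem not_middle_and_not_floor_of_hazama2003_of_deligne1982 (hF : deligne1982_cmDenseMumfordTateFamilies)
    (h83 : Hazama2003_generalHodge_cmType_of_hodge_codimTwo) :
    ¬ (MiddleHodgeFailureSpreadsToCMFibre ∧ ¬ HodgeFailureSpreadsToCMFibre) :=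
  fun h ↦ h.2 ((middleHodgeFailureSpreadsToCMFibre_iff_hodgeFailureSpreadsToCMFibre_of_hazama2003_of_deligne1982 hF h83).1 h.1)

/-- **NO MODEL SEPARATES THE ITEM FROM THE FLOOR granted the two records**: `¬(CMToAbelian ∧ ¬F_CM)`, MOD `hF ∧ h83` (both displayed).
[cite: Deligne1982HodgeCycles, Prop. 6.1 (a)(b) (p. 71)] [cite: Hazama2003GHCCM, Thm. 8.3 p. 655] -/
theorem not_cmToAbelian_and_not_floor_of_hazama2003_of_deligne1982 (hF : deligne1982_cmDenseMumfordTateFamilies)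
    (h83 : Hazama2003_generalHodge_cmType_of_hodge_codimTwo) : ¬ (CMToAbelian ∧ ¬ HodgeFailureSpreadsToCMFibre) :=
  fun h ↦ h.2 ((hodgeFailureSpreadsToCMFibre_iff_cmToAbelian_of_hazama2003_of_deligne1982 hF h83).2 h.1)

/-! ## §6 Modulo `h83` alone: the brief's closing theorem with `HC_CM` cut down to codimension two -/

/-- **`HC_AV ↔ HC_CM⁽2⁾ ∧ F_CM^mid`**, MOD `h83` (displayed): `→` is fact-free (restriction; part XXIV's on-path row); `←` is Hazama
(§2) followed by part XXIV's `HC_AV_of_HC_CM_and_middleHodgeFailureSpreadsToCMFibre`. The instance `B := F_CM^mid` of deform XIV's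
generic `closesWithCM_iff_codimTwo_of_hazama2003` (count once). [cite: Hazama2003GHCCM, Thm. 8.3 p. 655]
[cite: Milne2007TateFiniteFieldsAIM, Thm. 8.5] [cite: BrosnanFangNiePearlstein2009, §6 Lemma 48] -/
theorem HC_AV_iff_forall_codim_CM_two_and_middle_of_hazama2003 (h83 : Hazama2003_generalHodge_cmType_of_hodge_codimTwo) :
    HodgeAbelianVarieties ↔ (HC_CM⁽2⁾ ∧ MiddleHodgeFailureSpreadsToCMFibre) :=
  ⟨fun hAV ↦ ⟨fun A _ c hc hpp ↦ (hAV A).2 2 c hc hpp, onPathAV_middleHodgeFailureSpreadsToCMFibre hAV⟩,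
    fun h ↦ HC_AV_of_HC_CM_and_middleHodgeFailureSpreadsToCMFibre (HC_CM_of_forall_codim_CM_two_of_hazama2003 h83 h.1) h.2⟩

/-! ## §7 Modulo `hF ∧ h83`: the pointwise reading of `F_CM`, final form -/

/-- **POINTWISE READING of `F_CM`, final form**, MOD `hF ∧ h83` (both displayed): for every rational `(p,p)`-class `c` on `A` (ANY `p`),
the instance of `F_CM` at `(A, p, c)` holds iff (`c` is a Hodge failure ⟹ `HC_CM` fails) — for `p ≤ 1` both sides hold because `c` is
algebraic (part XXVI: `N⁰H⁰ = ⊤`, Lefschetz `(1,1)`); for `p ≥ 2` this is part XXV's pointwise reading (`¬HC_CM⁽p⁾`) and §2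
(`HC_CM⁽p⁾ ↔ HC_CM`). The anchored datum carries no information about `(A, p, c)` at all, modulo the two records.
[cite: Deligne1982HodgeCycles, Prop. 6.1 (a)(b) (p. 71)] [cite: Hazama2003GHCCM, Thm. 8.3 p. 655] -/
theorem hodgeFailureSpreadsToCMFibreAt_iff_not_HC_CM_of_hazama2003_of_deligne1982 (hF : deligne1982_cmDenseMumfordTateFamilies)
    (h83 : Hazama2003_generalHodge_cmType_of_hodge_codimTwo) {A : AbelianVariety ℂ} (hA : IsSmoothProjective A.dim A.X) {p : ℕ}
    {c : complexBetti A.X (2 * p)} (hc : IsRationalClass c) (hpp : IsOfHodgeType A.dim A.X (2 * p) p p c) :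
    (c ∉ algebraicClasses A.X p →
        ∃ (n : ℕ) (𝒳 S : SchemeOver ℂ) (f : 𝒳 ⟶ S) (s : ComplexPoints S) (W : complexBetti 𝒳 (2 * p)),
          IsCMAnchoredDatumFor A p c f n s W ∧
            ∃ s' ∈ cmLocus f n, complexBetti.map (fiberι f s') (2 * p) W ∉ algebraicClasses (fiberOver f s') p) ↔
      (c ∉ algebraicClasses A.X p → ¬ CMAbelianHodge) := by
  rcases Nat.lt_or_ge p 2 with hp | hp
  · have hmem : c ∈ algebraicClasses A.X p := forall_codim_AV_of_le (Nat.le_of_lt_succ hp) forall_codim_AV_one A c hc hpp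
    exact ⟨fun _ hnc ↦ absurd hmem hnc, fun _ hnc ↦ absurd hmem hnc⟩
  · exact (hodgeFailureSpreadsToCMFibreAt_iff_of_deligne1982 hF hA (by omega) hc hpp).trans
      (imp_congr_right fun _ ↦ not_congr (forall_codim_CM_iff_HC_CM_of_two_le_of_hazama2003 h83 hp))

/-! ## §8 The assembled reading -/

/-- **The spreading floor under Hazama's reduction, MOD `hF ∧ h83`** (both displayed, `HC_CM` never a binder): `CM↑`; `F_CM ↔ item`;
`F_CM^mid ↔ item`; `HC_AV ↔ HC_CM⁽2⁾ ∧ F_CM^mid`; and, fact-free (frame I), the item is the tautological exact complement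
`HC_AV ↔ HC_CM ∧ item` — the class everything collapses to. Nothing is decided; no case of the Hodge conjecture is proved.
[cite: Deligne1982HodgeCycles, Prop. 6.1 (a)(b) (p. 71)] [cite: Hazama2003GHCCM, Thm. 8.3 p. 655] [cite: Milne2007TateFiniteFieldsAIM, Thm. 8.5] -/
theorem spreadFloor_hazama_reading_of_deligne1982 (hF : deligne1982_cmDenseMumfordTateFamilies)
    (h83 : Hazama2003_generalHodge_cmType_of_hodge_codimTwo) :
    CM↑ ∧ (HodgeFailureSpreadsToCMFibre ↔ CMToAbelian) ∧ (MiddleHodgeFailureSpreadsToCMFibre ↔ CMToAbelian) ∧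
      (HodgeAbelianVarieties ↔ (HC_CM⁽2⁾ ∧ MiddleHodgeFailureSpreadsToCMFibre)) ∧ ExactWithCM CMToAbelian :=
  ⟨cmCodimUp_of_hazama2003 h83, hodgeFailureSpreadsToCMFibre_iff_cmToAbelian_of_hazama2003_of_deligne1982 hF h83,
    middleHodgeFailureSpreadsToCMFibre_iff_cmToAbelian_of_hazama2003_of_deligne1982 hF h83,
    HC_AV_iff_forall_codim_CM_two_and_middle_of_hazama2003 h83, exactWithCM_cmToAbelian⟩

end Summit.HodgeConjecture.HodgeConjecture.Ring2.AbelianAll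

end
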